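import Summits.BirchSwinnertonDyer.BirchSwinnertonDyer.Theses.TameQuarticManinParity
import Summits.BirchSwinnertonDyer.BirchSwinnertonDyer.Theorems.TameQuarticManinParityTwistPairAtThree
import Summits.BirchSwinnertonDyer.BirchSwinnertonDyer.Theorems.TameQuarticManinParityTwistLatticeDichotomyOfOptimalTwist
import Summits.BirchSwinnertonDyer.BirchSwinnertonDyer.Theorems.TameQuarticManinParityTameThreeOfColength
import Summits.BirchSwinnertonDyer.Rank1Residual.O5.CharTwistThreeIsometry
import Summits.BirchSwinnertonDyer.Rank1Residual.Additive.GordTwistDegreeIdentity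
import HarnessLib

/-!
# Route `TameQuarticManinParity`, G45 (LINE 45 glue): `CuspRegularTraceTwistTransfer → TprimeStarredTwistModelManinLe → CuspRegularFormsMemTameNeronLatticeOfCells → TprimeStarredNeronTraceDivisible` — glue item stmt-BirchSwinnertonDyer-24735 `TprimeStarredTraceDivisibleOfTwistTransfer`, BY NAME

Verbatim landing (leaf hand `leafhand-bsd-tamequarticmaninpa-1-g0`, cone of the cruxes 23736/23737, announced on the
bsd-eis STATUS before proposing) of the planner-of-record's kernel-checked glue, HOME `ideators/bsd-idea-3/ideas/l45/Sketch45b.lean sha16 d4244b2c7860c7b3 (bsd-idea-3 g13, 2026-08-29T13:31Z)`;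
there the route items were shadow `def`s (pre-render), here the theorem is stated against the rendered route decls
(route rev 87) — the proof script is the pen's, unchanged unless noted.  Glue only: the children and every crux above
stay OPEN; no summit is proved; BSD is NOT proved; Manin's conjecture is not proved.
-/

set_option autoImplicit false
-- D-0017: single-problem summit, so `Summit.BirchSwinnertonDyer.BirchSwinnertonDyer.…` repeats a namespace BY DESIGN.
set_option linter.dupNamespace false
namespace Summit.BirchSwinnertonDyer.BirchSwinnertonDyer.Theorems.TameQuarticManinParity

open Summit.BirchSwinnertonDyer.BirchSwinnertonDyer.Theses.TameQuarticManinParity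
open Literature.NumberTheory.EllipticCurves.ModularForms WeierstrassCurve CongruenceSubgroup
open Summit.BirchSwinnertonDyer.Rank1Residual.O5
open scoped MatrixGroups ModularForm

/-- **LINE 45 glue (G45).** TI45 → MT45 → LP42c → S*: for an optimal (t′) `III*` row `(W, D)` take the
MT45 datum `(V, D')` on the twist (`f_{D'} = R f_D`, `R f_{D'} = f_D`, both `3`-depleted newforms).
For every rational cusp-regular `g`: `g ∈ L` (LP42c) and carrier pullback integrality give
`⟨f_{D'}, g⟩ = t'·(c'/deg')·⟨f_{D'}, f_{D'}⟩`, `v₃(t') ≥ 0`; TI45 transfers this to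
`⟨f_D, g⟩ = t·(c'/deg')·⟨f_D, f_D⟩`, `v₃(t) ≥ 0`; Watkins `3·deg·c'² = deg'·u²·c²`, `v₃(u) = 1` and
`v₃(c') ≤ v₃(c)` then give `deg ⟨f, g⟩ = t₀·3·c·⟨f, f⟩` with `v₃(t₀) = v₃(c) − v₃(c') + v₃(t) ≥ 0`. -/
theorem tprimeStarredTraceDivisible_of_twistTransfer : TprimeStarredTraceDivisibleOfTwistTransfer := by
  intro hTI hMT hLP W _ _ _ hadd ht h9Δ D hopt hmin g hgq hgreg
  -- level data
  have h9N : 3 ^ 2 ∣ W.conductorNorm ℤ := TwistPairAtThree.nine_dvd_conductorNorm_of_addv W hadd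
  have hv2 : padicValNat 3 (W.conductorNorm ℤ) = 2 := padicValNat_conductorNorm_eq_two_of_subTprime W ht
  have hp2 : (3 : ℕ) ≠ 2 := by norm_num
  -- the character `χ₀ = (−3/·)`
  set χ₀ : DirichletCharacter ℂ 3 := (quadraticChar (ZMod 3)).ringHomComp (Int.castRingHom ℂ) with hχ₀
  have hχq : χ₀.IsQuadratic := isQuadratic_quadraticChar_ringHomComp 3
  have hχp : χ₀.IsPrimitive := isPrimitive_quadraticChar_ringHomComp 3 hp2
  -- the Manin-side datum on the twist model (MT45)
  obtain ⟨V, _, _, C, hC, D', hopt', hcle⟩ := hMT W hadd ht h9Δ D hopt hmin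
  have e3 : ((-1 : ℚ) ^ (3 / 2) * 3 : ℚ) = -3 := by norm_num
  have hC' : C • W.quadraticTwist ((-1 : ℚ) ^ (3 / 2) * 3) = V := by rw [e3]; exact hC
  obtain ⟨haddV, -⟩ := TwistPairAtThree.addv_and_subTprime_of_twist_negThree W V C hadd ht hC'
  have hu1 : padicValRat 3 (C.u : ℚ) = 1 :=
    (TwistPairAtThree.padicValRat_u_eq_one_of_IIIstar W V C hadd ht h9Δ hC').1
  haveI : (W.quadraticTwist (-3 : ℚ)).IsElliptic := W.isElliptic_quadraticTwist (by norm_num)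
  have hiso : IsIsogenous (W.quadraticTwist (-3 : ℚ)) V := isIsogenous_of_smul_eq hC
  -- coefficient relation `aₙ(f_{D'}) = χ₀(n) aₙ(f_D)`, so `f_{D'} = R f_D` and `R f_{D'} = f_D`
  have hrel := fun n ↦ cuspCoeff_rel_of_twist_negThree haddV hadd hiso D' D n
  have hfV : D'.f = charTwist (W.conductorNorm ℤ) (dvd_refl _) h9N hχq D.f := by
    refine eq_of_forall_cuspCoeff_eq_gamma0 fun n ↦ ?_
    rw [cuspCoeff_charTwist _ _ _ hχq hχp, (hrel n).1]
  have hdepW : ∀ n, 3 ∣ n → cuspCoeff D.f n = 0 := by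
    intro n hn
    rw [D.isNewformOf.2 n, W.LFunction_apply_eq_zero_of_not_good_of_not_mult 3 hadd.1 hadd.2 hn]
    push_cast
    rfl
  have hdepV : ∀ n, 3 ∣ n → cuspCoeff D'.f n = 0 := by
    intro n hn
    rw [hfV]
    exact cuspCoeff_charTwist_eq_zero_of_dvd h9N hχq hχp D.f hn
  have hRfV : charTwist (W.conductorNorm ℤ) (dvd_refl _) h9N hχq D'.f = D.f := by
    rw [hfV]
    exact charTwist_charTwist h9N hχq hχp hdepW
  -- `f_{D'}` is a rational `3`-depleted newform whose twist `f_D` is a newform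
  have hnewV : IsNewform0 D'.f := D'.isNewformOf.1
  have hnewRV : IsNewform0 (charTwist (W.conductorNorm ℤ) (dvd_refl _) h9N hχq D'.f) := by
    rw [hRfV]; exact D.isNewformOf.1
  have hfVq : ∀ n : ℕ, ∃ q : ℚ, (q : ℂ) = cuspCoeff D'.f n := by
    intro n
    refine ⟨(V.LFunction n : ℚ), ?_⟩
    rw [D'.isNewformOf.2 n]
    push_cast
    rfl
  -- nonvanishing
  have hdeg0 : (D.modularDegree : ℚ) ≠ 0 := by exact_mod_cast D.deg_pos.ne'
  have hdeg0' : (D'.modularDegree : ℚ) ≠ 0 := by exact_mod_cast D'.deg_pos.ne'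
  have hc0 : (D.maninConstant : ℚ) ≠ 0 := by exact_mod_cast D.maninConstant_ne_zero_holds
  have hc0' : (D'.maninConstant : ℚ) ≠ 0 := by exact_mod_cast D'.maninConstant_ne_zero_holds
  have hu0 : (C.u : ℚ) ≠ 0 := C.u.ne_zero
  have h3v : padicValRat 3 (3 : ℚ) = 1 := by exact_mod_cast padicValRat.self (p := 3) (by norm_num)
  have hdegC' : (D'.modularDegree : ℂ) ≠ 0 := by exact_mod_cast D'.deg_pos.ne'
  -- the trace ideal of the cusp-regular lattice against `f_{D'}` (type III side): LP42c + carrier pullback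
  obtain ⟨Λ, hΛ⟩ := hLP W hadd ht
  have hhyp : ∀ g' : CuspForm (Gamma0 (W.conductorNorm ℤ)) 2,
      (∀ n : ℕ, ∃ q : ℚ, (q : ℂ) = cuspCoeff g' n) →
      (∀ (γ : SL(2, ℤ)) (ι : PadicAlgCl 3 ≃+* ℂ) (n : ℕ),
        ‖ι.symm (fourierCoeffAtCusp (W.conductorNorm ℤ) 2 ⇑g' γ n)‖ ≤
          (3 : ℝ) ^ (((padicValNat 3 (W.conductorNorm ℤ) -
              padicValNat 3 (cuspDenominator (W.conductorNorm ℤ) γ) : ℕ) : ℝ) -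
            cesnaviciusNeururerSahaCuspBound 3 (padicValNat 3 (cuspDenominator (W.conductorNorm ℤ) γ))
              (padicValNat 3 (W.conductorNorm ℤ)))) →
      ∃ t : ℚ, 0 ≤ padicValRat 3 t ∧
        peterssonProduct (Gamma0 (W.conductorNorm ℤ)) 2 D'.f g' =
          (t : ℂ) * (((D'.maninConstant : ℚ) / (D'.modularDegree : ℚ) : ℚ) : ℂ) *
            peterssonProduct (Gamma0 (W.conductorNorm ℤ)) 2 D'.f D'.f := by
    intro g' hg'q hg'reg
    obtain ⟨t', ht'v, ht'⟩ := Λ.pullback_integral V D' hopt' g' (hΛ g' hg'q hg'reg)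
    refine ⟨t', ht'v, ?_⟩
    push_cast
    field_simp
    linear_combination ht'
  -- TI45: transfer to the twist `R f_{D'} = f_D`
  obtain ⟨t, htv, htid⟩ := hTI (W.conductorNorm ℤ) hv2 h9N χ₀ hχq hχp D'.f hnewV hnewRV hfVq hdepV
    ((D'.maninConstant : ℚ) / (D'.modularDegree : ℚ)) hhyp g hgq hgreg
  rw [hRfV] at htid
  -- Watkins: `3·deg·c'² = deg'·u²·c²`
  have hWat : (3 : ℚ) * D.modularDegree * (D'.maninConstant : ℚ) ^ 2 =
      D'.modularDegree * (C.u : ℚ) ^ 2 * (D.maninConstant : ℚ) ^ 2 := by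
    have hC3 : C • W.quadraticTwist ((-1 : ℚ) ^ ((3 : ℕ) / 2) * ((3 : ℕ) : ℚ)) = V := by
      rw [show ((-1 : ℚ) ^ ((3 : ℕ) / 2) * ((3 : ℕ) : ℚ) : ℚ) = -3 by norm_num]; exact hC
    have := Summit.BirchSwinnertonDyer.Rank1Residual.Additive.twist_modularDegree_identity 3 hp2 W V hadd
      haddV C hC3 D D'
    exact_mod_cast this
  -- the witness `t₀ = deg·t·c' / (3·deg'·c)`
  refine ⟨(D.modularDegree : ℚ) * t * (D'.maninConstant : ℚ) /
      (3 * (D'.modularDegree : ℚ) * (D.maninConstant : ℚ)), ?_, ?_⟩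
  · -- valuation: `v₃(t₀) = v₃(c) − v₃(c') + v₃(t) ≥ 0`
    by_cases ht0 : t = 0
    · simp [ht0]
    have e1 := congrArg (padicValRat 3) hWat
    rw [padicValRat.mul (mul_ne_zero (by norm_num) hdeg0) (pow_ne_zero _ hc0'),
      padicValRat.mul (by norm_num) hdeg0,
      padicValRat.mul (mul_ne_zero hdeg0' (pow_ne_zero _ hu0)) (pow_ne_zero _ hc0),
      padicValRat.mul hdeg0' (pow_ne_zero _ hu0),
      padicValRat.pow, padicValRat.pow, padicValRat.pow, hu1,
      padicValRat.of_nat, padicValRat.of_nat, padicValRat.of_int, padicValRat.of_int, h3v] at e1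
    rw [padicValRat.div (mul_ne_zero (mul_ne_zero hdeg0 ht0) hc0')
        (mul_ne_zero (mul_ne_zero (by norm_num) hdeg0') hc0),
      padicValRat.mul (mul_ne_zero hdeg0 ht0) hc0', padicValRat.mul hdeg0 ht0,
      padicValRat.mul (mul_ne_zero (by norm_num) hdeg0') hc0, padicValRat.mul (by norm_num) hdeg0',
      padicValRat.of_nat, padicValRat.of_nat, padicValRat.of_int, padicValRat.of_int, h3v]
    have hcle' : ((padicValInt 3 D'.maninConstant : ℕ) : ℤ) ≤ padicValInt 3 D.maninConstant := by
      exact_mod_cast hcle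
    push_cast at e1 ⊢
    omega
  · -- the identity `deg ⟨f, g⟩ = t₀ · 3 · c · ⟨f, f⟩`
    rw [htid]
    have hcC : (D.maninConstant : ℂ) ≠ 0 := by exact_mod_cast D.maninConstant_ne_zero_holds
    push_cast
    field_simp

end Summit.BirchSwinnertonDyer.BirchSwinnertonDyer.Theorems.TameQuarticManinParity
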